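/-
Copyright (c) 2026 the pub-hodgecm-mathlib formalisation cell (harness21).  R90-TF SLAB, section S10 (Rogawski 1990, §13.6–13.8 read at `v`),
prover R90-C138-p08 (g0) — DEAL #20-b (R90-C138-plan (g3) 2026-09-05T01:24:01Z, RULING J-M3-5), step 2∕2 «assembly»; h413 = `stmt-HodgeConjecture-24833`, route `HCCMUnconditional`.
-/
import Summits.HodgeConjecture.HodgeConjecture.Theorems.R90S10SplitSigmaDictionaryRep          -- (J1-adm) `splitSigmaDictionary_rep` (this seat, step 1∕2)
import Summits.HodgeConjecture.HodgeConjecture.Theorems.R90S3SplitTransportParabolicIndGL3      -- ★ J2 `R90.S3.splitTransport_parabolicIndGL3`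
import Summits.HodgeConjecture.HodgeConjecture.Theorems.R90S3VanDijkParabolicIndGLAdmissible    -- ★ VD `R90.S3.GLn.vanDijkTraceParabolicIndGL_admissible_lastBlockLabel_three`
import Summits.HodgeConjecture.HodgeConjecture.Theorems.R90S10FrozenDatumDefs                   -- ★ C2 currency `Pl`, `Gqs`, `HLoc`, `H1Loc` (the letter's tokens)
import Literature.NumberTheory.Automorphic.CMPrincipalSeriesHAdmissible                         -- ★ `isAdmissible_cmPrincipalSeriesH`
import HarnessLib

/-!
# R90-TF ∕ S10 — THE SPLIT-PLACE ABSTRACT TRANSFER (payer core of (M-b′) `SplitAbstractTransferLetter`, RULING J-M3-5): for every ADMISSIBLE `ρ_w` on `H_w` at a place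
# of `L⁺` split in `L` there is an ADMISSIBLE `I` on `G_w = U(Φ₃)(L⁺_w)` with `Tr I(φ) = Tr ρ_w(τ_w · φ̄^P)` for every test `φ`
# (`Theorems/R90S10SplitAbstractTransferCore.lean`; ns `Summit.HodgeConjecture.HodgeConjecture.R90.S10`; LAW L9: ★ `Theorems` ∕ Literature imports only; THEOREMS ONLY)

Print: [Rogawski1990] §4.13 Lemma 4.13.1 (b) pp. 64–66 («if `v` splits … `Tr i_G(σ̃)(f) = Tr σ(τ_v · f̄^P)`», van Dijk on both sides), §4.9 Lemma 4.9.2 pp. 55–56, §12.1 p. 171,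
§13.8 p. 217 («if `v` splits in `E` … (∗) holds»); [vanDijk1972] Thm. p. 237; [BernsteinZelevinsky1977] Prop. 2.3.

## WHAT THIS FILE PROVES (census `R90/R90-C138-p08/g0/CENSUS-Mb-inductionInStages.md` items 1–3 + (M-d); NO induction in stages, NO principal-series model)
At `W ∣ w` with `c • W ≠ W`, take `I := i_c(σ′) ∘ e′` where `σ′ = (ρ_w ⊗ χ) ∘ Θ⁻¹` is the dictionary datum of (J1-adm) `splitSigmaDictionary_rep`, `i_c =` ★ `Representation.parabolicIndGL`
(`c = lastBlockLabel 3`), `e′ =` ★ `localSplitEquiv : G_w ≃ₜ* GL₃(L_W)`.  Then, for every `φ ∈ C_c^∞(G_w)`: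
`Tr I(φ; νQw) = Tr i_c(σ′)(φ ∘ e′⁻¹; ν)` (★ J2, `ν = e′_* νQw`, `ν(GL₃(𝒪)) = νQw(K′)`) `= (ν(GL₃𝒪)∕ν_M(M ∩ GL₃𝒪)) · tr(σ′_M ⊗ δ^{1∕2})(m ↦ ∫_{K×U} φ(e′⁻¹(k m u k⁻¹)))` (★ VD)
`= (νQw(K′)∕ν_M(M ∩ GL₃𝒪)) · (same)` `= Tr ρ_w(τ_w · φ̄^P; νHw)` ((J1-adm)) — with the SAME `ν_M` on both sides (VD holds for every Haar `ν_M`; J1-adm produces one).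
`I` is admissible: ★ `isAdmissible_parabolicIndGL_holds` + ★ `IsAdmissible.comp_mulEquiv`.
* `exists_admissible_smoothTrace_eq_cmSplitTransfer` — generic hermitian `H′` with `det H′` a unit, any admissible `ρ_w`;
* `exists_admissible_smoothTrace_eq_cmSplitTransfer_qsForm` — the S10 instance `H′ = Φ₃` on ★ `Gqs L w` ∕ `HLoc L w` with the letter's proof tokens
  `antidiagOne_isHermitian L 3`, `isUnit_antidiagOne_det L 3` (= p06 (g0)'s (M-b)∕(M-b′) `cmSplitTransfer` term VERBATIM);
* `exists_admissible_smoothTrace_eq_cmSplitTransfer_of_equiv_cmPrincipalSeriesH` — the letter's binder shape: `(χ₂, χ₁)`, `IsOpen χ₁.ker`, `ρ_w ≅ i_H(χ₂ ⊠ χ₁)`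
  (admissibility by ★ `isAdmissible_cmPrincipalSeriesH` + ★ `IsAdmissible.of_equiv`) ⇒ the (M-b′) conclusion — so `splitAbstractTransferLetter_holds := fun W hW χ₂ χ₁ hχ₁ _ _ _ ρw hρ
  => …_of_equiv_cmPrincipalSeriesH …` once p01 (g0)'s ★ def `SplitAbstractTransferLetter` is in the tree (one-line follow-up file).
HONEST LABEL: bookkeeping over ★ J1 (generalised here as J1-adm) ∕ ★ VD ∕ ★ J2 ∕ ★ admissibility lemmas; pays no socket until the letter (M-b′) and letter (3′) consumers name it;
HC_CM is proved only modulo the 7 printed citations (2 remaining named inputs: hLiu418 = `stmt-HodgeConjecture-24832`, h413 = `stmt-HodgeConjecture-24833`) until rung 0 closes;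
REL ≠ ★ ≠ BUILT.
-/

set_option autoImplicit false
set_option linter.dupNamespace false

noncomputable section

namespace Summit.HodgeConjecture.HodgeConjecture.R90.S10

open MeasureTheory IsDedekindDomain NumberField
open Literature.NumberTheory Literature.NumberTheory.Automorphic Literature.NumberTheory.Automorphic.UnitaryGroup
open Literature.NumberTheory.Rogawski1990 Literature.NumberTheory.GaloisRepresentations
open Summit.HodgeConjecture.HodgeConjecture.Cruxes.H413.K2E1TraceFormulaBeta
open Summit.HodgeConjecture.HodgeConjecture.R90.S3 (splitTransport_parabolicIndGL3 GLn.vanDijkTraceParabolicIndGL_admissible_lastBlockLabel_three)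
open scoped Matrix

section Generic

variable (L : Type) [Field L] [NumberField L] [IsCMField L] (H' : Matrix (Fin 3) (Fin 3) L)
  (v : HeightOneSpectrum (𝓞 ↥(maximalRealSubfield L)))

set_option maxHeartbeats 800000 in  -- three long ★ statements instantiated and chained; no single heavy step
/-- **THE SPLIT-PLACE ABSTRACT TRANSFER** (generic hermitian `H′`, `det H′` a unit): at `w ∣ v` with `c • w ≠ w`, for every ADMISSIBLE `ρ_v` on `H_v = U(Φ₂)(L⁺_v) × U(Φ₁)(L⁺_v)`
there is an ADMISSIBLE representation `I` of `G′_v = U(H′)(L⁺_v)` — namely `i_c(σ′) ∘ e′` for the (J1-adm) dictionary datum `σ′` — with `Tr I(φ; νG) = Tr ρ_v(τ_v · φ̄^P; νH)` for every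
`φ ∈ C_c^∞(G′_v)` (`τ_v · φ̄^P =` ★ `cmSplitTransfer`).  PROOF: ★ J2 (transport to `GL₃(L_w)`, `ν = e′_* νG`, `ν(GL₃𝒪) = νG(K′)`) + ★ VD (van Dijk for `i_c(σ′)` on `GL₃`) + (J1-adm),
both sides being `(νG(K′)∕ν_M(M ∩ GL₃𝒪)) · tr(σ′_M ⊗ δ^{1∕2})(∫_{K×U} φ ∘ e′⁻¹)`. [cite: Rogawski1990, §4.13 Lemma 4.13.1 (b) pp. 64–66; §4.9 Lemma 4.9.2 pp. 55–56]
[cite: vanDijk1972, Thm. p. 237] [cite: BernsteinZelevinsky1977, Prop. 2.3] -/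
theorem exists_admissible_smoothTrace_eq_cmSplitTransfer
    (hH' : (H'.map (cmConjRingHom L))ᵀ = H') (hH'd : IsUnit H'.det) (μ : HeckeCharacter L)
    [MeasurableSpace ((UnitaryGroup.cmDatum L 3 H').Local v)] [BorelSpace ((UnitaryGroup.cmDatum L 3 H').Local v)]
    [MeasurableSpace ((UnitaryGroup.cmDatum L 2 (Matrix.of fun i j : Fin 2 => if i.val + j.val + 1 = 2 then (1 : L) else 0)).Local v ×
      (UnitaryGroup.cmDatum L 1 (Matrix.of fun i j : Fin 1 => if i.val + j.val + 1 = 1 then (1 : L) else 0)).Local v)]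
    [BorelSpace ((UnitaryGroup.cmDatum L 2 (Matrix.of fun i j : Fin 2 => if i.val + j.val + 1 = 2 then (1 : L) else 0)).Local v ×
      (UnitaryGroup.cmDatum L 1 (Matrix.of fun i j : Fin 1 => if i.val + j.val + 1 = 1 then (1 : L) else 0)).Local v)]
    (νH : Measure ((UnitaryGroup.cmDatum L 2 (Matrix.of fun i j : Fin 2 => if i.val + j.val + 1 = 2 then (1 : L) else 0)).Local v ×
      (UnitaryGroup.cmDatum L 1 (Matrix.of fun i j : Fin 1 => if i.val + j.val + 1 = 1 then (1 : L) else 0)).Local v))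
    [νH.IsHaarMeasure]
    (νG : Measure ((UnitaryGroup.cmDatum L 3 H').Local v)) [νG.IsHaarMeasure]
    (w : UnitaryGroup.PlacesOver L v) (hw : IsCMField.complexConj L • w.1 ≠ w.1)
    {Vw : Type} [AddCommGroup Vw] [Module ℂ Vw]
    (ρw : Representation ℂ ((UnitaryGroup.cmDatum L 2 (Matrix.of fun i j : Fin 2 => if i.val + j.val + 1 = 2 then (1 : L) else 0)).Local v ×
      (UnitaryGroup.cmDatum L 1 (Matrix.of fun i j : Fin 1 => if i.val + j.val + 1 = 1 then (1 : L) else 0)).Local v) Vw)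
    (hρw : ρw.IsAdmissible) :
    ∃ (Wsp : Type) (_ : AddCommGroup Wsp) (_ : Module ℂ Wsp) (I : Representation ℂ ((UnitaryGroup.cmDatum L 3 H').Local v) Wsp),
      I.IsAdmissible ∧
        ∀ φ : (UnitaryGroup.cmDatum L 3 H').Local v → ℂ, IsLocSmooth φ →
          I.smoothTrace νG φ = ρw.smoothTrace νH (UnitaryGroup.cmSplitTransfer L H' hH' hH'd v w hw μ νH νG φ) := by
  classical
  letI : MeasurableSpace (GL (Fin 3) (w.1.adicCompletion L)) := borel _
  haveI : BorelSpace (GL (Fin 3) (w.1.adicCompletion L)) := ⟨rfl⟩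
  -- (J1-adm): the dictionary datum `σ′` and the `M`-side Haar measure `ν_M`
  obtain ⟨W', _, _, σ', hσ', νM, hνM, hJ1⟩ := splitSigmaDictionary_rep L H' v hH' hH'd μ νH νG w hw ρw hρw
  -- (J2): the transported Haar measure `ν = e′_* νG` on `GL₃(L_w)` and the character transport for `i_c(σ′) ∘ e′`
  obtain ⟨ν, hν, hνK, hsm, hJ2⟩ := splitTransport_parabolicIndGL3 L H' v hH' hH'd νG w hw
  haveI := hν
  haveI := hνM
  -- the split-place isomorphism `e′` (TYPED ON THE CM CARRIER `(cmDatum L 3 H′).Local v`, as in ★ J2, so that `I` lives on the statement's carrier and instances agree)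
  let e : (UnitaryGroup.cmDatum L 3 H').Local v ≃ₜ* GL (Fin 3) (w.1.adicCompletion L) :=
    UnitaryGroup.localSplitEquiv (IsCMField.complexConj L) H' (IsCMField.complexConj_ne_one L)
      ((UnitaryGroup.map_cmConjRingHom_eq_map_complexConj L H') ▸ hH') w hw
      (UnitaryGroup.isUnit_placeForm_of_isUnit_det hH'd w.1)
  -- `I := i_c(σ′) ∘ e′` is admissible (★ `isAdmissible_parabolicIndGL_holds`, transported along `e′` by ★ `IsAdmissible.comp_mulEquiv`)
  have hadmI := (Representation.isAdmissible_parabolicIndGL_holds (w.1.adicCompletion L) (Zelevinsky1980.lastBlockLabel 3) σ' hσ').comp_mulEquiv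
    e.toMulEquiv e.continuous e.toHomeomorph.isOpenMap
  refine ⟨_, inferInstance, inferInstance, _, hadmI, fun φ hφ => ?_⟩
  -- `Tr (i_c σ′ ∘ e′)(φ; νG) = Tr i_c σ′ (φ ∘ e′⁻¹; ν)` (J2; `e` unfolds by `refine`, not by `rw`) `= C_ν · tr(…)(F̄)` (VD) and `Tr ρ_w(τ·φ̄^P) = C_G · tr(…)(F̄)` (J1-adm),
  -- `C_ν = C_G` by `ν(GL₃𝒪) = νG(K′)`
  refine (hJ2 W' σ' hσ' φ hφ).trans ?_
  rw [GLn.vanDijkTraceParabolicIndGL_admissible_lastBlockLabel_three (F := w.1.adicCompletion L) W' σ' hσ' ν νM _ (hsm φ hφ).1 (hsm φ hφ).2,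
    hJ1 φ hφ, hνK]

end Generic

/-! ## The S10 instance `H′ = Φ₃`: tokens of ★ C2 (`Gqs`, `HLoc`, `Pl`) and of p06 (g0)'s split letters -/

section QuasiSplit

variable (L : Type) [Field L] [NumberField L] [IsCMField L] (μ : HeckeCharacter L) (w : Pl L)
  [MeasurableSpace (HLoc L w)] [BorelSpace (HLoc L w)] [MeasurableSpace (Gqs L w)] [BorelSpace (Gqs L w)]
  (νQw : Measure (Gqs L w)) (νHw : Measure (HLoc L w)) [νQw.IsHaarMeasure] [νHw.IsHaarMeasure]

/-- **THE SPLIT-PLACE ABSTRACT TRANSFER ON `G_w = U(Φ₃)(L⁺_w)`** — the (M-b′) conclusion for every ADMISSIBLE `ρ_w` (the `cmSplitTransfer` term = p06 (g0)'s letter bytes: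
`UnitaryGroup.cmSplitTransfer L (qsForm L) (antidiagOne_isHermitian L 3) (isUnit_antidiagOne_det L 3) w W hW μ νHw νQw φ`).
[cite: Rogawski1990, §4.13 Lemma 4.13.1 (b) pp. 64–66; §4.9 Lemma 4.9.2 pp. 55–56] [cite: vanDijk1972, Thm. p. 237] -/
theorem exists_admissible_smoothTrace_eq_cmSplitTransfer_qsForm (W : PlacesOver L w) (hW : IsCMField.complexConj L • W.1 ≠ W.1)
    {Vw : Type} [AddCommGroup Vw] [Module ℂ Vw] (ρw : Representation ℂ (HLoc L w) Vw) (hρw : ρw.IsAdmissible) :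
    ∃ (Wsp : Type) (_ : AddCommGroup Wsp) (_ : Module ℂ Wsp) (I : Representation ℂ (Gqs L w) Wsp),
      I.IsAdmissible ∧ ∀ φ : Gqs L w → ℂ, IsLocSmooth φ →
        I.smoothTrace νQw φ =
          ρw.smoothTrace νHw (UnitaryGroup.cmSplitTransfer L (qsForm L) (antidiagOne_isHermitian L 3) (isUnit_antidiagOne_det L 3) w W hW μ νHw νQw φ) :=
  exists_admissible_smoothTrace_eq_cmSplitTransfer L (qsForm L) w (antidiagOne_isHermitian L 3) (isUnit_antidiagOne_det L 3) μ νHw νQw W hW ρw hρw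

/-- **THE (M-b′) CONCLUSION IN THE LETTER'S BINDER SHAPE** — for every inducing pair `(χ₂, χ₁)` (`χ₁` with open kernel) and every realisation `ρ_w ≅ i_H(χ₂ ⊠ χ₁)`
(★ `cmPrincipalSeriesH`; admissible by ★ `isAdmissible_cmPrincipalSeriesH`, transported along the isomorphism by ★ `IsAdmissible.of_equiv`): the abstract transfer partner
`I` exists.  `splitAbstractTransferLetter_holds` is this theorem under p01 (g0)'s ★ `SplitAbstractTransferLetter` binder (one line, once that def is in the tree).
[cite: Rogawski1990, §4.13 Lemma 4.13.1 (b) pp. 64–66; §12.1 p. 171] [cite: BernsteinZelevinsky1977, Prop. 2.3] -/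
theorem exists_admissible_smoothTrace_eq_cmSplitTransfer_of_equiv_cmPrincipalSeriesH (W : PlacesOver L w) (hW : IsCMField.complexConj L • W.1 ≠ W.1)
    (χ₂ : ↥(torusU (conjLocal L (IsCMField.complexConj L) w) (cmLocalForm L 2 w)) →* ℂˣ) (χ₁ : H1Loc L w →* ℂˣ)
    (hχ₁ : IsOpen ((χ₁.ker : Subgroup (H1Loc L w)) : Set (H1Loc L w)))
    {Vw : Type} [AddCommGroup Vw] [Module ℂ Vw] (ρw : Representation ℂ (HLoc L w) Vw)
    (hρ : Nonempty (ρw.Equiv (cmPrincipalSeriesH L w χ₂ χ₁))) :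
    ∃ (Wsp : Type) (_ : AddCommGroup Wsp) (_ : Module ℂ Wsp) (I : Representation ℂ (Gqs L w) Wsp),
      I.IsAdmissible ∧ ∀ φ : Gqs L w → ℂ, IsLocSmooth φ →
        I.smoothTrace νQw φ =
          ρw.smoothTrace νHw (UnitaryGroup.cmSplitTransfer L (qsForm L) (antidiagOne_isHermitian L 3) (isUnit_antidiagOne_det L 3) w W hW μ νHw νQw φ) := by
  obtain ⟨e⟩ := hρ
  have hadm : ρw.IsAdmissible := (isAdmissible_cmPrincipalSeriesH L w χ₂ χ₁ hχ₁).of_equiv e.symm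
  exact exists_admissible_smoothTrace_eq_cmSplitTransfer_qsForm L μ w νQw νHw W hW ρw hadm

end QuasiSplit

end Summit.HodgeConjecture.HodgeConjecture.R90.S10

end
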